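import Summits.AtomisticToContinuum.HydrodynamicLimit.Theorems.CollisionIsometryCLTMacroClosureBarycentricDefs
import Summits.AtomisticToContinuum.HydrodynamicLimit.Theorems.CollisionIsometryCLTMacroClosureStubBalanceB3
import Summits.AtomisticToContinuum.HydrodynamicLimit.Theorems.CollisionIsometryCLTMacroClosureStubBalanceB4
import Literature.MathematicalPhysics.KineticTheory.HardSphereBBGKYLiouvilleFlow
import Literature.Analysis.FluidPDE.HardSphereMomentumConservation
import HarnessLib

/-!
# Stub `stub_clausius` of the line `IdeatorTwoGen1Sketch` (crux `MacroClosure`, stmt-14870), part 3: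
# totals of the block fields and their conservation; the block variance identity

Support file (`--supports stmt-AtomisticToContinuum-14870`) for the registered stub
`Barycentric.stub_clausius`; it lands the registered sub-goal `stub_clausius_totals`. Deterministic
block-field calculus for a continuous kernel `φ` of mass `1` and a configuration `w` of `N + 1` spheres:

* `∫ₓ ρ̄ dx = 1`, `∫ₓ m̄ dx = (N+1)⁻¹ Σᵢ vᵢ`, `∫ₓ Ē dx = (N+1)⁻¹ Σᵢ |vᵢ|²/2`, hence
  `∫ₓ Ū(w, x) dx = (1, p(w), e(w))` with the per-particle momentum `p` and kinetic energy `e`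
  (Fubini over the finite empirical sum and `∫ φ(xᵢ − x) dx = ∫ φ = 1`, Haar invariance);
* `p`, `e` are conserved along good orbits of every hard-sphere flow
  (`HardSphereFlow.configMomentum_flow`, `HardSphereFlow.configEnergy_flow`);
* the variance identity `(Σwᵢ)(Σwⱼ|vⱼ|²) − |Σwᵢvᵢ|² = ½ ΣᵢΣⱼ wᵢwⱼ|vᵢ − vⱼ|²` for non-negative
  weights, giving `|m̄|² ≤ 2ρ̄Ē` (non-negative block temperature) and STRICT inequality as soon as two
  particles with distinct velocities carry positive weight.
-/

noncomputable section

open MeasureTheory Filter Set Topology InformationTheory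
open scoped ENNReal ContDiff InnerProductSpace

namespace Summit.AtomisticToContinuum.HydrodynamicLimit.Theorems.MacroClosureLine

open Literature.MathematicalPhysics.KineticTheory Literature.Analysis.FluidPDE
open Literature.Analysis.FunctionSpaces

namespace Barycentric

namespace Clausius

/-! ## Per-particle momentum and kinetic energy: the empirical fields of the observable `1` -/

variable {N : ℕ}

/-- Per-particle momentum `p(w) = ⟨emp w, v⟩ = (N+1)⁻¹ Σᵢ vᵢ`. [folklore] -/
theorem empiricalMomentumField_one (w : Config (N + 1) (Fin 3) T3) :
    empiricalMomentumField w (fun _ => (1 : ℝ)) = ((N + 1 : ℕ) : ℝ)⁻¹ • ∑ i, (w i).2 := by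
  rw [empiricalMomentumField_eq_sum]
  simp

/-- Per-particle kinetic energy `e(w) = ⟨emp w, |v|²/2⟩ = (N+1)⁻¹ Σᵢ |vᵢ|²/2`. [folklore] -/
theorem empiricalEnergyField_one (w : Config (N + 1) (Fin 3) T3) :
    empiricalEnergyField w (fun _ => (1 : ℝ)) = ((N + 1 : ℕ) : ℝ)⁻¹ * ∑ i, ‖(w i).2‖ ^ 2 / 2 := by
  rw [empiricalEnergyField_eq_sum]
  simp

/-- `p = (N+1)⁻¹ · configMomentum`. [folklore] -/
theorem empiricalMomentumField_one_eq_configMomentum (w : Config (N + 1) (Fin 3) T3) :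
    empiricalMomentumField w (fun _ => (1 : ℝ)) = ((N + 1 : ℕ) : ℝ)⁻¹ • configMomentum w :=
  empiricalMomentumField_one w

/-- `e = (N+1)⁻¹ · configEnergy`. [folklore] -/
theorem empiricalEnergyField_one_eq_configEnergy (w : Config (N + 1) (Fin 3) T3) :
    empiricalEnergyField w (fun _ => (1 : ℝ)) = ((N + 1 : ℕ) : ℝ)⁻¹ * configEnergy w := by
  have h : ∑ i, ‖(w i).2‖ ^ 2 / 2 = 2⁻¹ * ∑ i, ‖(w i).2‖ ^ 2 := by
    rw [Finset.mul_sum]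
    exact Finset.sum_congr rfl fun i _ => by ring
  rw [empiricalEnergyField_one, h]
  rfl

/-- The per-particle kinetic energy is non-negative. [folklore] -/
theorem empiricalEnergyField_one_nonneg (w : Config (N + 1) (Fin 3) T3) :
    0 ≤ empiricalEnergyField w (fun _ => (1 : ℝ)) := by
  rw [empiricalEnergyField_one]
  exact mul_nonneg (inv_nonneg.2 (Nat.cast_nonneg _)) (Finset.sum_nonneg fun i _ => by positivity)

/-- `‖p‖ ≤ 1/2 + e` (termwise `‖v‖ ≤ (1 + ‖v‖²)/2`). [folklore] -/
theorem norm_empiricalMomentumField_one_le (w : Config (N + 1) (Fin 3) T3) :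
    ‖empiricalMomentumField w (fun _ => (1 : ℝ))‖ ≤ 1 / 2 + empiricalEnergyField w (fun _ => (1 : ℝ)) := by
  have hN : (0 : ℝ) < ((N + 1 : ℕ) : ℝ) := by positivity
  rw [empiricalMomentumField_one, empiricalEnergyField_one, norm_smul, Real.norm_eq_abs,
    abs_of_pos (inv_pos.2 hN)]
  have hterm : ∀ i : Fin (N + 1), ‖(w i).2‖ ≤ 1 / 2 + ‖(w i).2‖ ^ 2 / 2 := fun i => by
    nlinarith [sq_nonneg (‖(w i).2‖ - 1), norm_nonneg (w i).2]
  calc ((N + 1 : ℕ) : ℝ)⁻¹ * ‖∑ i, (w i).2‖ ≤ ((N + 1 : ℕ) : ℝ)⁻¹ * ∑ i, ‖(w i).2‖ :=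
        mul_le_mul_of_nonneg_left (norm_sum_le _ _) (inv_nonneg.2 hN.le)
    _ ≤ ((N + 1 : ℕ) : ℝ)⁻¹ * ∑ i : Fin (N + 1), (1 / 2 + ‖(w i).2‖ ^ 2 / 2) :=
        mul_le_mul_of_nonneg_left (Finset.sum_le_sum fun i _ => hterm i) (inv_nonneg.2 hN.le)
    _ = 1 / 2 + ((N + 1 : ℕ) : ℝ)⁻¹ * ∑ i, ‖(w i).2‖ ^ 2 / 2 := by
        rw [Finset.sum_add_distrib, Finset.sum_const, Finset.card_univ, Fintype.card_fin,
          nsmul_eq_mul, mul_add, ← mul_assoc, inv_mul_cancel₀ hN.ne', one_mul]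

/-! ## Conservation along good orbits -/

/-- Momentum and kinetic energy per particle are conserved along good orbits of a hard-sphere flow.
[folklore] -/
theorem totals_flow {σ : ℝ} (Φ : Flow σ N) {z : Config (N + 1) (Fin 3) T3} (hz : z ∈ Φ.good)
    (s : ℝ) : empiricalMomentumField (Φ.flow s z) (fun _ => (1 : ℝ)) =
        empiricalMomentumField z (fun _ => (1 : ℝ)) ∧
      empiricalEnergyField (Φ.flow s z) (fun _ => (1 : ℝ)) = empiricalEnergyField z (fun _ => (1 : ℝ)) := by
  constructor
  · rw [empiricalMomentumField_one_eq_configMomentum, empiricalMomentumField_one_eq_configMomentum,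
      Φ.configMomentum_flow hz s]
  · rw [empiricalEnergyField_one_eq_configEnergy, empiricalEnergyField_one_eq_configEnergy,
      Φ.configEnergy_flow hz s]

/-! ## Totals of the block fields -/

section Totals

variable {φ : T3 → ℝ} (hφc : Continuous φ) (hφ1 : ∫ y, φ y = 1)
include hφc

/-- `x ↦ φ(xᵢ − x)` is integrable on `𝕋³`. [folklore] -/
theorem integrable_translate (y : T3) : Integrable fun x : T3 => φ (y - x) :=
  B4.integrable_comp_sub_left (integrable_of_continuous_T3 hφc) y

/-- The block density is continuous in the block centre. [folklore] -/
theorem continuous_bρ (w : Config (N + 1) (Fin 3) T3) : Continuous fun x => bρ φ w x := by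
  simp only [bρ_eq_sum]
  fun_prop

/-- The block momentum is continuous in the block centre. [folklore] -/
theorem continuous_bm (w : Config (N + 1) (Fin 3) T3) : Continuous fun x => bm φ w x := by
  have : (fun x => bm φ w x) = fun x => ((N + 1 : ℕ) : ℝ)⁻¹ • ∑ i, φ ((w i).1 - x) • (w i).2 := by
    funext x
    simp only [bm, empiricalMomentumField]
    rw [integral_empiricalMeasure_V3]
  rw [this]
  fun_prop

/-- The block energy is continuous in the block centre. [folklore] -/
theorem continuous_bE (w : Config (N + 1) (Fin 3) T3) : Continuous fun x => bE φ w x := by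
  simp only [bE_eq_sum]
  fun_prop

include hφ1

/-- `∫ₓ ρ̄(w, x) dx = 1`. [folklore] -/
theorem integral_bρ (w : Config (N + 1) (Fin 3) T3) : ∫ x, bρ φ w x = 1 := by
  have hN : ((N + 1 : ℕ) : ℝ) ≠ 0 := by positivity
  simp only [bρ_eq_sum]
  rw [integral_const_mul, integral_finsetSum _ fun i _ => integrable_translate hφc _]
  simp_rw [MesoLLN.integral_comp_sub_left φ, hφ1]
  rw [Finset.sum_const, Finset.card_univ, Fintype.card_fin, nsmul_eq_mul, mul_one]
  exact inv_mul_cancel₀ hN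

/-- `∫ₓ m̄(w, x) dx = p(w)`. [folklore] -/
theorem integral_bm (w : Config (N + 1) (Fin 3) T3) :
    ∫ x, bm φ w x = empiricalMomentumField w (fun _ => (1 : ℝ)) := by
  rw [empiricalMomentumField_one]
  have hrepr : ∀ x, bm φ w x = ((N + 1 : ℕ) : ℝ)⁻¹ • ∑ i, φ ((w i).1 - x) • (w i).2 := fun x => by
    simp only [bm, empiricalMomentumField]
    rw [integral_empiricalMeasure_V3]
  simp_rw [hrepr]
  rw [integral_smul, integral_finsetSum _ fun i _ => (integrable_translate hφc _).smul_const _]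
  simp_rw [integral_smul_const, MesoLLN.integral_comp_sub_left φ, hφ1, one_smul]

/-- `∫ₓ Ē(w, x) dx = e(w)`. [folklore] -/
theorem integral_bE (w : Config (N + 1) (Fin 3) T3) :
    ∫ x, bE φ w x = empiricalEnergyField w (fun _ => (1 : ℝ)) := by
  rw [empiricalEnergyField_one]
  simp only [bE_eq_sum]
  rw [integral_const_mul, integral_finsetSum _ fun i _ => (integrable_translate hφc _).mul_const _]
  simp_rw [integral_mul_const, MesoLLN.integral_comp_sub_left φ, hφ1, one_mul]

/-- **Totals of the block state**: `∫ₓ Ū(w, x) dx = (1, p(w), e(w))`. [folklore] -/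
theorem integral_bU (w : Config (N + 1) (Fin 3) T3) : ∫ x, bU φ w x =
    ((1 : ℝ), empiricalMomentumField w (fun _ => (1 : ℝ)), empiricalEnergyField w (fun _ => (1 : ℝ))) := by
  have h1 : Integrable (fun x => bρ φ w x) := integrable_of_continuous_T3 (continuous_bρ hφc w)
  have h2 : Integrable (fun x => bm φ w x) := integrable_of_continuous_T3 (continuous_bm hφc w)
  have h3 : Integrable (fun x => bE φ w x) := integrable_of_continuous_T3 (continuous_bE hφc w)
  simp only [bU]
  rw [integral_pair h1 (h2.prodMk h3), integral_pair h2 h3, integral_bρ hφc hφ1, integral_bm hφc hφ1,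
    integral_bE hφc hφ1]

end Totals

/-! ## The variance identity and the sign of the block temperature -/

/-- **Weighted variance identity** in a real inner product space:
`(Σwᵢ)(Σwⱼ‖vⱼ‖²) − ‖Σwᵢvᵢ‖² = ½ ΣᵢΣⱼ wᵢwⱼ‖vᵢ − vⱼ‖²`. [folklore] -/
theorem variance_identity {ι : Type*} (s : Finset ι) (wt : ι → ℝ) (v : ι → V3) :
    (∑ i ∈ s, wt i) * (∑ j ∈ s, wt j * ‖v j‖ ^ 2) - ‖∑ i ∈ s, wt i • v i‖ ^ 2 =
      2⁻¹ * ∑ i ∈ s, ∑ j ∈ s, wt i * wt j * ‖v i - v j‖ ^ 2 := by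
  have hnorm : ‖∑ i ∈ s, wt i • v i‖ ^ 2 = ∑ i ∈ s, ∑ j ∈ s, wt i * wt j * ⟪v i, v j⟫_ℝ := by
    rw [← real_inner_self_eq_norm_sq, sum_inner]
    refine Finset.sum_congr rfl fun i _ => ?_
    rw [inner_sum]
    refine Finset.sum_congr rfl fun j _ => ?_
    rw [real_inner_smul_left, real_inner_smul_right]
    ring
  have hprod : (∑ i ∈ s, wt i) * (∑ j ∈ s, wt j * ‖v j‖ ^ 2) =
      2⁻¹ * ∑ i ∈ s, ∑ j ∈ s, wt i * wt j * (‖v i‖ ^ 2 + ‖v j‖ ^ 2) := by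
    rw [Finset.sum_mul_sum]
    have hsym : ∑ i ∈ s, ∑ j ∈ s, wt i * wt j * ‖v i‖ ^ 2 =
        ∑ i ∈ s, ∑ j ∈ s, wt i * wt j * ‖v j‖ ^ 2 := by
      rw [Finset.sum_comm]
      exact Finset.sum_congr rfl fun i _ => Finset.sum_congr rfl fun j _ => by ring
    have hsplit : ∑ i ∈ s, ∑ j ∈ s, wt i * wt j * (‖v i‖ ^ 2 + ‖v j‖ ^ 2) =
        (∑ i ∈ s, ∑ j ∈ s, wt i * wt j * ‖v i‖ ^ 2) + ∑ i ∈ s, ∑ j ∈ s, wt i * wt j * ‖v j‖ ^ 2 := by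
      rw [← Finset.sum_add_distrib]
      refine Finset.sum_congr rfl fun i _ => ?_
      rw [← Finset.sum_add_distrib]
      exact Finset.sum_congr rfl fun j _ => by ring
    rw [hsplit, hsym, ← two_mul, ← mul_assoc, inv_mul_cancel₀ two_ne_zero, one_mul]
    exact Finset.sum_congr rfl fun i _ => Finset.sum_congr rfl fun j _ => by ring
  rw [hnorm, hprod, Finset.mul_sum, Finset.mul_sum, ← Finset.sum_sub_distrib]
  refine Finset.sum_congr rfl fun i _ => ?_
  rw [Finset.mul_sum, Finset.mul_sum, ← Finset.sum_sub_distrib]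
  refine Finset.sum_congr rfl fun j _ => ?_
  rw [norm_sub_sq_real]
  ring

/-- Block fields as weighted sums: `(N+1) ρ̄ = Σ wᵢ`, `(N+1) m̄ = Σ wᵢ vᵢ`, `(N+1) Ē = Σ wᵢ|vᵢ|²/2`
with `wᵢ = φ(xᵢ − x)`. [folklore] -/
theorem block_sums (φ : T3 → ℝ) (w : Config (N + 1) (Fin 3) T3) (x : T3) :
    ((N + 1 : ℕ) : ℝ) * bρ φ w x = ∑ i, φ ((w i).1 - x) ∧
    ((N + 1 : ℕ) : ℝ) • bm φ w x = ∑ i, φ ((w i).1 - x) • (w i).2 ∧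
    ((N + 1 : ℕ) : ℝ) * bE φ w x = ∑ i, φ ((w i).1 - x) * (‖(w i).2‖ ^ 2 / 2) := by
  have hN : ((N + 1 : ℕ) : ℝ) ≠ 0 := by positivity
  refine ⟨?_, ?_, ?_⟩
  · rw [bρ_eq_sum, ← mul_assoc, mul_inv_cancel₀ hN, one_mul]
  · have : bm φ w x = ((N + 1 : ℕ) : ℝ)⁻¹ • ∑ i, φ ((w i).1 - x) • (w i).2 := by
      simp only [bm, empiricalMomentumField]
      rw [integral_empiricalMeasure_V3]
    rw [this, smul_smul, mul_inv_cancel₀ hN, one_smul]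
  · rw [bE_eq_sum, ← mul_assoc, mul_inv_cancel₀ hN, one_mul]

/-- **Cauchy–Schwarz for blocks**: `‖m̄‖² ≤ 2 ρ̄ Ē` for a non-negative kernel. [folklore] -/
theorem norm_bm_sq_le {φ : T3 → ℝ} (hφ0 : ∀ y, 0 ≤ φ y) (w : Config (N + 1) (Fin 3) T3) (x : T3) :
    ‖bm φ w x‖ ^ 2 ≤ 2 * bρ φ w x * bE φ w x := by
  have hN : (0 : ℝ) < ((N + 1 : ℕ) : ℝ) := by positivity
  obtain ⟨h1, h2, h3⟩ := block_sums φ w x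
  have hvar := variance_identity Finset.univ (fun i => φ ((w i).1 - x)) (fun i => (w i).2)
  have hrhs : 0 ≤ 2⁻¹ * ∑ i, ∑ j, φ ((w i).1 - x) * φ ((w j).1 - x) * ‖(w i).2 - (w j).2‖ ^ 2 :=
    mul_nonneg (by norm_num) (Finset.sum_nonneg fun i _ => Finset.sum_nonneg fun j _ =>
      mul_nonneg (mul_nonneg (hφ0 _) (hφ0 _)) (sq_nonneg _))
  have hE2 : ∑ j, φ ((w j).1 - x) * ‖(w j).2‖ ^ 2 = 2 * (((N + 1 : ℕ) : ℝ) * bE φ w x) := by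
    rw [h3, Finset.mul_sum]
    exact Finset.sum_congr rfl fun j _ => by ring
  rw [← h1, ← h2, hE2, norm_smul, mul_pow, Real.norm_eq_abs, abs_of_pos hN] at hvar
  have key : 0 ≤ ((N + 1 : ℕ) : ℝ) ^ 2 * (2 * bρ φ w x * bE φ w x - ‖bm φ w x‖ ^ 2) := by
    have e : ((N + 1 : ℕ) : ℝ) ^ 2 * (2 * bρ φ w x * bE φ w x - ‖bm φ w x‖ ^ 2) =
        ((N + 1 : ℕ) : ℝ) * bρ φ w x * (2 * (((N + 1 : ℕ) : ℝ) * bE φ w x)) -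
          ((N + 1 : ℕ) : ℝ) ^ 2 * ‖bm φ w x‖ ^ 2 := by ring
    rw [e, hvar]
    exact hrhs
  nlinarith [key, pow_pos hN 2]

/-- **Strict Cauchy–Schwarz**: if two particles with distinct velocities carry positive weight in
the block at `x`, then `‖m̄‖² < 2 ρ̄ Ē`. [folklore] -/
theorem norm_bm_sq_lt {φ : T3 → ℝ} (hφ0 : ∀ y, 0 ≤ φ y) (w : Config (N + 1) (Fin 3) T3) (x : T3)
    {a b : Fin (N + 1)} (ha : 0 < φ ((w a).1 - x)) (hb : 0 < φ ((w b).1 - x))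
    (hv : (w a).2 ≠ (w b).2) : ‖bm φ w x‖ ^ 2 < 2 * bρ φ w x * bE φ w x := by
  have hN : (0 : ℝ) < ((N + 1 : ℕ) : ℝ) := by positivity
  obtain ⟨h1, h2, h3⟩ := block_sums φ w x
  have hvar := variance_identity Finset.univ (fun i => φ ((w i).1 - x)) (fun i => (w i).2)
  set T : Fin (N + 1) → Fin (N + 1) → ℝ := fun i j =>
    φ ((w i).1 - x) * φ ((w j).1 - x) * ‖(w i).2 - (w j).2‖ ^ 2 with hT
  have hT0 : ∀ i j, 0 ≤ T i j := fun i j =>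
    mul_nonneg (mul_nonneg (hφ0 _) (hφ0 _)) (sq_nonneg _)
  have hab : 0 < T a b := by
    simp only [hT]
    exact mul_pos (mul_pos ha hb) (pow_pos (norm_pos_iff.2 (sub_ne_zero.2 hv)) 2)
  have hrhs : 0 < 2⁻¹ * ∑ i, ∑ j, T i j := by
    refine mul_pos (by norm_num) (lt_of_lt_of_le hab ?_)
    calc T a b ≤ ∑ j, T a j := Finset.single_le_sum (fun j _ => hT0 a j) (Finset.mem_univ b)
      _ ≤ ∑ i, ∑ j, T i j :=
          Finset.single_le_sum (fun i _ => Finset.sum_nonneg fun j _ => hT0 i j) (Finset.mem_univ a)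
  have hE2 : ∑ j, φ ((w j).1 - x) * ‖(w j).2‖ ^ 2 = 2 * (((N + 1 : ℕ) : ℝ) * bE φ w x) := by
    rw [h3, Finset.mul_sum]
    exact Finset.sum_congr rfl fun j _ => by ring
  rw [← h1, ← h2, hE2, norm_smul, mul_pow, Real.norm_eq_abs, abs_of_pos hN] at hvar
  have key : 0 < ((N + 1 : ℕ) : ℝ) ^ 2 * (2 * bρ φ w x * bE φ w x - ‖bm φ w x‖ ^ 2) := by
    have e : ((N + 1 : ℕ) : ℝ) ^ 2 * (2 * bρ φ w x * bE φ w x - ‖bm φ w x‖ ^ 2) =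
        ((N + 1 : ℕ) : ℝ) * bρ φ w x * (2 * (((N + 1 : ℕ) : ℝ) * bE φ w x)) -
          ((N + 1 : ℕ) : ℝ) ^ 2 * ‖bm φ w x‖ ^ 2 := by ring
    rw [e, hvar]
    exact hrhs
  nlinarith [key, pow_pos hN 2]

/-- The block temperature in terms of `2ρ̄Ē − ‖m̄‖²`: `θ̄ = (2ρ̄Ē − ‖m̄‖²)/(3ρ̄²)` (also for `ρ̄ = 0`,
both sides being `0`). [folklore] -/
theorem stateTemp_bU (φ : T3 → ℝ) (w : Config (N + 1) (Fin 3) T3) (x : T3) :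
    stateTemp (bU φ w x) = (2 * bρ φ w x * bE φ w x - ‖bm φ w x‖ ^ 2) / (3 * bρ φ w x ^ 2) := by
  simp only [stateTemp, bU]
  by_cases hρ : bρ φ w x = 0
  · rw [hρ]; simp
  · field_simp
    try ring

/-- **Non-negative block temperature** for a non-negative kernel. [folklore] -/
theorem stateTemp_bU_nonneg {φ : T3 → ℝ} (hφ0 : ∀ y, 0 ≤ φ y) (w : Config (N + 1) (Fin 3) T3)
    (x : T3) : 0 ≤ stateTemp (bU φ w x) := by
  rw [stateTemp_bU]
  exact div_nonneg (by linarith [norm_bm_sq_le hφ0 w x]) (by positivity)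

/-- **Positive block temperature** when two particles with distinct velocities carry positive
weight. [folklore] -/
theorem stateTemp_bU_pos {φ : T3 → ℝ} (hφ0 : ∀ y, 0 ≤ φ y) (w : Config (N + 1) (Fin 3) T3) (x : T3)
    {a b : Fin (N + 1)} (ha : 0 < φ ((w a).1 - x)) (hb : 0 < φ ((w b).1 - x))
    (hv : (w a).2 ≠ (w b).2) : 0 < stateTemp (bU φ w x) := by
  have hρ : 0 < bρ φ w x := by
    rw [bρ_eq_sum]
    refine mul_pos (by positivity) (lt_of_lt_of_le ha ?_)
    exact Finset.single_le_sum (f := fun i => φ ((w i).1 - x)) (fun i _ => hφ0 _) (Finset.mem_univ a)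
  rw [stateTemp_bU]
  exact div_pos (by linarith [norm_bm_sq_lt hφ0 w x ha hb hv]) (by positivity)

/-- **Entropy floor for blocks**: `−Ē − 1 ≤ η_σ(Ū)` for a non-negative kernel (the sure floor
`−(3/2)ρθ(U) − 1 ≤ η_σ(U)` of `stub_engine_entropyFloor` and `(3/2)ρ̄θ̄ = Ē − ‖m̄‖²/(2ρ̄) ≤ Ē`).
[folklore] -/
theorem neg_bE_sub_one_le_hsEntropy (σ : ℝ) {φ : T3 → ℝ} (hφ0 : ∀ y, 0 ≤ φ y)
    (w : Config (N + 1) (Fin 3) T3) (x : T3) : -bE φ w x - 1 ≤ hsEntropy σ (bU φ w x) := by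
  have hρ0 : 0 ≤ bρ φ w x := by
    rw [bρ_eq_sum]; exact mul_nonneg (by positivity) (Finset.sum_nonneg fun i _ => hφ0 _)
  have hE0 : 0 ≤ bE φ w x := by
    rw [bE_eq_sum]
    exact mul_nonneg (by positivity) (Finset.sum_nonneg fun i _ => mul_nonneg (hφ0 _) (by positivity))
  have hθ0 := stateTemp_bU_nonneg hφ0 w x
  have hfloor := stub_engine_entropyFloor σ (bU φ w x) hρ0 hθ0
  have hkin : (bU φ w x).1 * stateTemp (bU φ w x) ≤ 2 / 3 * bE φ w x := by
    show bρ φ w x * stateTemp (bU φ w x) ≤ 2 / 3 * bE φ w x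
    rw [stateTemp_bU]
    rcases hρ0.eq_or_lt with h | h
    · rw [← h]; simp only [zero_mul]; linarith
    · rw [mul_div_assoc']
      rw [div_le_iff₀ (by positivity)]
      nlinarith [sq_nonneg ‖bm φ w x‖, h, hE0]
  linarith

end Clausius

/-- Registered sub-goal `stub_clausius_totals` of the stub `stub_clausius`: for a continuous kernel of
mass one, the totals of the block state are the conserved per-particle quantities,
`∫ₓ Ū(w,x) dx = (1, p(w), e(w))` with `p = (N+1)⁻¹Σvᵢ`, `e = (N+1)⁻¹Σ|vᵢ|²/2`, and `p`, `e` are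
invariant along good orbits of every hard-sphere flow (`Clausius.integral_bU`, `Clausius.totals_flow`).
[folklore] -/
theorem stub_clausius_totals : ∀ (σ : ℝ) (N : ℕ) (Φ : Flow σ N) (φ : T3 → ℝ), Continuous φ → ∫ y, φ y = 1 → ∀ z ∈ Φ.good, ∀ s : ℝ, ∫ x, bU φ (Φ.flow s z) x = ((1 : ℝ), ((N + 1 : ℕ) : ℝ)⁻¹ • ∑ i, (z i).2, ((N + 1 : ℕ) : ℝ)⁻¹ * ∑ i, ‖(z i).2‖ ^ 2 / 2) := by
  intro σ N Φ φ hφc hφ1 z hz s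
  rw [Clausius.integral_bU hφc hφ1]
  obtain ⟨hp, he⟩ := Clausius.totals_flow Φ hz s
  rw [hp, he, Clausius.empiricalMomentumField_one, Clausius.empiricalEnergyField_one]

end Barycentric

end Summit.AtomisticToContinuum.HydrodynamicLimit.Theorems.MacroClosureLine

end
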